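import Summits.QuantumAdvantage.QuantumAdvantage.Theorems.LinnikCubicClassGroupsDegreeOnePrimesEscapeSplittingTypeDivision
import Summits.QuantumAdvantage.QuantumAdvantage.Theorems.LinnikCubicClassGroupsDegreeOnePrimesEscapeNonsplitPrimeAnyField
import Mathlib.GroupTheory.Index
import Mathlib.GroupTheory.GroupAction.Quotient
import HarnessLib

/-!
# Splitting types along a permutation representation `Gal(N/ℚ) → S_n` (every number field)

Topic `Summits/QuantumAdvantage/QuantumAdvantage/Theorems`, cell B2b-1 (linnik-cubic), PART A (gen 14);
helper toward the crux `DegreeOnePrimesEscape` (stmt-QuantumAdvantage-11543) of route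
`LinnikCubicClassGroups`.  HONEST FRAMING: the value of this file is a THEOREM (kernel-checked group theory
and Dedekind–Frobenius bookkeeping) — NOT summit progress.

`…SplittingTypeDivision.lean` proved Dedekind's dictionary "splitting type of `p` in `K` = full cycle type
of `ψ(Frob_p)`" for `S_n`-fields, along an ISOMORPHISM `ψ : Gal(N/ℚ) ≃* S_n`.  For an arbitrary number
field `K` of degree `n` with Galois closure `N` one only has a permutation representation
`ψ : Gal(N/ℚ) →* Perm (Fin n)` (the action on the `n` cosets of `H = Gal(N/K)`, i.e. on the `n`
embeddings `K → N`) under which `H` is the stabiliser of `0`; it is transitive because `[G : H] = n`.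
This file proves the dictionary in that generality:

* `exists_apply_zero_eq` — transitivity from `[G : H] = n` (orbit–stabiliser);
* `natCard_conj_mem_eq_mul_card_fixed` — the permutation character: `#{t : t x t⁻¹ ∈ H} = |H| · #Fix(ψ x)`;
* `splittingType_eq_fullCycleType_of_hom` — for a prime `Q ∣ p` of `N` with trivial inertia and
  Frobenius `φ`: `splittingType K' p = cycleType (ψ φ) + (#fixed points) · {1}` (`K' = N^H`);
* `fullCycleType_conj` — the full cycle type of `ψ g` is a class function of `g`;
* `frobenius_mem_cycleTypeSet_iff` — at `p ∤ d_N`: "`Frob_p ∈ {g : full cycle type of ψ g = T}`" `↔`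
  `splittingType K' p = T`;
* `exists_galoisClosure_perm` — every number field `K` of degree `n` has a Galois closure `N`
  (`[N:ℚ] ≤ n!`, `|d_N| ≤ |d_K|^{[N:ℚ]}`), an embedding `f : K → N` and such a `ψ` with
  `Gal(N/f K) = Stab(0)` (the coset action).

References: R. Dedekind (1894); R. Perlis, J. Number Theory 9 (1977) §1 [Perlis1977].
-/

noncomputable section

open scoped NumberField nonZeroDivisors
open Finset Ideal NumberField
open Literature.NumberTheory.NumberFields Literature.NumberTheory.LFunctions
  Literature.NumberTheory.LFunctions.NumberField

namespace Summit.QuantumAdvantage.QuantumAdvantage.Theorems.DegreeOnePrimesEscape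

/-! ### Group theory: a transitive permutation representation with point stabiliser `H` -/

section Group

variable {G : Type*} [Group G] {n : ℕ} [NeZero n] (ψ : G →* Equiv.Perm (Fin n)) (H : Subgroup G)
  (hstab : ∀ g : G, g ∈ H ↔ ψ g 0 = 0)

include hstab in
/-- **Transitivity from the index**: if `H = Stab(0)` has index `n`, every `i : Fin n` is `ψ g 0` for
some `g` (orbit–stabiliser). -/
theorem exists_apply_zero_eq [Finite G] (hind : H.index = n) (i : Fin n) : ∃ g : G, ψ g 0 = i := by
  letI : MulAction G (Fin n) := MulAction.compHom (Fin n) ψ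
  have hst : MulAction.stabilizer G (0 : Fin n) = H := by
    ext g
    rw [MulAction.mem_stabilizer_iff, hstab]
    rfl
  have horb : (MulAction.orbit G (0 : Fin n)).ncard = n := by
    rw [← MulAction.index_stabilizer, hst, hind]
  have huniv : MulAction.orbit G (0 : Fin n) = Set.univ :=
    Set.eq_of_subset_of_ncard_le (Set.subset_univ _)
      (by rw [Set.ncard_univ, Nat.card_eq_fintype_card, Fintype.card_fin, horb])
  have hi : i ∈ MulAction.orbit G (0 : Fin n) := by rw [huniv]; exact Set.mem_univ _
  obtain ⟨g, hg⟩ := MulAction.mem_orbit_iff.mp hi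
  exact ⟨g, hg⟩

include hstab in
/-- An element of `H` fixes `0`, and so does its inverse permutation. -/
theorem perm_inv_apply_zero_of_mem {h : G} (hh : h ∈ H) : (ψ h)⁻¹ 0 = 0 := by
  rw [Equiv.Perm.inv_eq_iff_eq]
  exact ((hstab h).mp hh).symm

include hstab in
/-- The fibres of `t ↦ (ψ t)⁻¹ 0` are right cosets of `H`: each has `|H|` elements. -/
theorem card_filter_perm_inv_apply_zero_eq [Fintype G] [DecidableEq G] (t₀ : G) :
    (Finset.univ.filter fun t : G => (ψ t)⁻¹ 0 = (ψ t₀)⁻¹ 0).card = Nat.card H := by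
  classical
  rw [← Fintype.card_subtype, ← Nat.card_eq_fintype_card]
  -- `t t₀⁻¹ ∈ H` on the fibre, and `H t₀` lies in the fibre
  have hto : ∀ t : G, (ψ t)⁻¹ 0 = (ψ t₀)⁻¹ 0 → t * t₀⁻¹ ∈ H := by
    intro t ht
    rw [hstab, map_mul, map_inv, Equiv.Perm.mul_apply, ← ht]
    exact (ψ t).apply_symm_apply 0
  have hinv : ∀ h : G, h ∈ H → (ψ (h * t₀))⁻¹ 0 = (ψ t₀)⁻¹ 0 := by
    intro h hh
    rw [map_mul, mul_inv_rev, Equiv.Perm.mul_apply, perm_inv_apply_zero_of_mem ψ H hstab hh]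
  exact Nat.card_congr
    { toFun := fun t => ⟨t.1 * t₀⁻¹, hto t.1 t.2⟩
      invFun := fun h => ⟨h.1 * t₀, hinv h.1 h.2⟩
      left_inv := fun t => Subtype.ext (by simp)
      right_inv := fun h => Subtype.ext (by simp) }

include hstab in
/-- **The permutation character of a point stabiliser**: if `H = Stab(0)` has index `n` then
`#{t ∈ G : t x t⁻¹ ∈ H} = |H| · #{i : ψ x i = i}` for every `x ∈ G`. -/
theorem natCard_conj_mem_eq_mul_card_fixed [Finite G] (hind : H.index = n) (x : G) :
    Nat.card {t : G // t * x * t⁻¹ ∈ H} =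
      Nat.card H * (Finset.univ.filter fun i : Fin n => ψ x i = i).card := by
  classical
  have hfin := Fintype.ofFinite G
  rw [Nat.card_eq_fintype_card, Fintype.card_subtype]
  -- `t x t⁻¹ ∈ H ↔ ψ x` fixes `(ψ t)⁻¹ 0`
  have hiff : ∀ t : G, t * x * t⁻¹ ∈ H ↔ ψ x ((ψ t)⁻¹ 0) = (ψ t)⁻¹ 0 := by
    intro t
    rw [hstab, map_mul, map_mul, map_inv, Equiv.Perm.mul_apply, Equiv.Perm.mul_apply,
      ← Equiv.Perm.inv_eq_iff_eq.symm.trans (Iff.intro Eq.symm Eq.symm), eq_comm]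
  rw [Finset.filter_congr (fun t _ => hiff t)]
  rw [Finset.card_eq_sum_card_fiberwise (f := fun t : G => (ψ t)⁻¹ 0)
    (t := Finset.univ.filter fun i : Fin n => ψ x i = i) (fun t ht => by
      have ht' := (Finset.mem_filter.mp (Finset.mem_coe.mp ht)).2
      exact Finset.mem_coe.mpr (Finset.mem_filter.mpr ⟨Finset.mem_univ _, ht'⟩))]
  rw [mul_comm]
  refine Finset.sum_const_nat fun i hi => ?_
  have hi' : ψ x i = i := (Finset.mem_filter.mp hi).2
  obtain ⟨s, hs⟩ := exists_apply_zero_eq ψ H hstab hind i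
  have ht₀ : (ψ s⁻¹)⁻¹ 0 = i := by rw [map_inv, inv_inv, hs]
  rw [Finset.filter_filter]
  have heq : (Finset.univ.filter fun t : G =>
      ψ x ((ψ t)⁻¹ 0) = (ψ t)⁻¹ 0 ∧ (ψ t)⁻¹ 0 = i) =
      Finset.univ.filter fun t : G => (ψ t)⁻¹ 0 = (ψ s⁻¹)⁻¹ 0 := by
    refine Finset.filter_congr fun t _ => ?_
    rw [ht₀]
    constructor
    · rintro ⟨-, h⟩; exact h
    · intro h; rw [h]; exact ⟨hi', rfl⟩
  rw [heq]
  exact card_filter_perm_inv_apply_zero_eq ψ H hstab s⁻¹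

omit [NeZero n] in
/-- **The full cycle type of `ψ g` is a class function of `g`.** -/
theorem fullCycleType_conj (g h : G) :
    (ψ (h * g * h⁻¹)).cycleType + Multiset.replicate (n - (ψ (h * g * h⁻¹)).support.card) 1 =
      (ψ g).cycleType + Multiset.replicate (n - (ψ g).support.card) 1 := by
  rw [map_mul, map_mul, map_inv, Equiv.Perm.cycleType_conj, Equiv.Perm.card_support_conj]

omit [NeZero n] in
/-- The set of elements with a given full cycle type is conjugation-invariant. -/
theorem conjInvariant_cycleTypeSet (T : Multiset ℕ) :
    ∀ g h : G, g ∈ {g : G | (ψ g).cycleType + Multiset.replicate (n - (ψ g).support.card) 1 = T} →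
      h * g * h⁻¹ ∈ {g : G | (ψ g).cycleType + Multiset.replicate (n - (ψ g).support.card) 1 = T} := by
  intro g h hg
  rw [Set.mem_setOf_eq, fullCycleType_conj ψ g h]
  exact hg

end Group

/-! ### The dictionary for an arbitrary number field -/

section Field

variable {N : Type} [Field N] [NumberField N] [IsGalois ℚ N] {n : ℕ} [NeZero n]
  (K' : IntermediateField ℚ N) (ψ : (N ≃ₐ[ℚ] N) →* Equiv.Perm (Fin n))
  (hstab : ∀ g : N ≃ₐ[ℚ] N, g ∈ K'.fixingSubgroup ↔ ψ g 0 = 0)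

/-- `[Gal(N/ℚ) : Gal(N/K')] = [K' : ℚ]`. -/
theorem index_fixingSubgroup_eq_finrank : K'.fixingSubgroup.index = Module.finrank ℚ K' := by
  have h1 : Nat.card K'.fixingSubgroup * K'.fixingSubgroup.index = Nat.card (N ≃ₐ[ℚ] N) :=
    Subgroup.card_mul_index _
  rw [IsGalois.card_fixingSubgroup_eq_finrank K', IsGalois.card_aut_eq_finrank,
    ← Module.finrank_mul_finrank ℚ K' N, mul_comm] at h1
  exact Nat.eq_of_mul_eq_mul_right Module.finrank_pos h1

include hstab in
/-- **Dedekind's dictionary along a permutation representation**: if `Gal(N/K') = Stab_ψ(0)` with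
`[K':ℚ] = n`, and `φ` is a Frobenius at a prime `Q ∣ p` of `N` with trivial inertia, then
`splittingType K' p` is the full cycle type of `ψ φ` (the residue degrees of `p` in `K'` are the orbit
lengths of `⟨φ⟩` on the cosets of `Gal(N/K')`). [cite: Perlis1977, §1] -/
theorem splittingType_eq_fullCycleType_of_hom (hK' : Module.finrank ℚ K' = n) {p : ℕ} (hp : p.Prime)
    (Q : Ideal (𝓞 N)) [Q.IsMaximal] [Q.LiesOver (span {(p : ℤ)})] {φ : N ≃ₐ[ℚ] N}
    (hφ : IsArithFrobAt ℤ φ Q) (hI : Q.inertia (N ≃ₐ[ℚ] N) = ⊥) :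
    splittingType K' p = (ψ φ).cycleType + Multiset.replicate (n - (ψ φ).support.card) 1 := by
  classical
  have hind : K'.fixingSubgroup.index = n := (index_fixingSubgroup_eq_finrank K').trans hK'
  haveI : Finite K'.fixingSubgroup := inferInstance
  have hH : 0 < Nat.card K'.fixingSubgroup := Nat.card_pos
  have hsums : ∀ j : ℕ, ((splittingType K' p).filter (· ∣ j)).sum =
      (((ψ φ).cycleType + Multiset.replicate (Fintype.card (Fin n) - (ψ φ).support.card) 1).filter
        (· ∣ j)).sum := by
    intro j
    have hk := card_fixingSubgroup_mul_sum_filter_dvd K' hp Q hφ hI j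
    rw [natCard_conj_mem_eq_mul_card_fixed ψ K'.fixingSubgroup hstab hind, map_pow] at hk
    rw [sum_filter_dvd_fullCycleType, ← Nat.eq_of_mul_eq_mul_left hH hk]
  have h := eq_of_forall_sum_filter_dvd_eq _ _ _ rfl (fun f hf => splittingType_pos hp hf)
    (fun f hf => pos_of_mem_fullCycleType (ψ φ) hf) hsums
  simpa only [Fintype.card_fin] using h

include hstab in
/-- **Frobenius cycle types are splitting types**, for every number field: at a prime `p ∤ d_N`,
"some prime `Q ∣ p` with trivial inertia has a Frobenius `φ` whose full cycle type under `ψ` is `T`"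
holds iff `splittingType K' p = T`. [cite: Perlis1977, §1] [cite: LagariasMontgomeryOdlyzko1979, §1] -/
theorem frobenius_mem_cycleTypeSet_iff (hK' : Module.finrank ℚ K' = n) (T : Multiset ℕ) {p : ℕ}
    (hp : p.Prime) (hpN : ¬ ((p : ℤ) ∣ NumberField.discr N)) :
    (∃ (Q : Ideal (𝓞 N)) (_ : Q.IsMaximal) (_ : Q.LiesOver (span {(p : ℤ)})) (φ : N ≃ₐ[ℚ] N),
        IsArithFrobAt ℤ φ Q ∧ Q.inertia (N ≃ₐ[ℚ] N) = ⊥ ∧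
          φ ∈ {g : N ≃ₐ[ℚ] N | (ψ g).cycleType + Multiset.replicate (n - (ψ g).support.card) 1 = T}) ↔
      splittingType K' p = T := by
  constructor
  · rintro ⟨Q, hQ, hQp, φ, hφ, hI, hT⟩
    rw [Set.mem_setOf_eq] at hT
    rw [← hT]
    exact splittingType_eq_fullCycleType_of_hom K' ψ hstab hK' hp Q hφ hI
  · intro hT
    obtain ⟨Q, hQ, hQp, ⟨φ, hφ⟩, hI⟩ := exists_isArithFrobAt_of_not_dvd_discr (N := N) hp hpN
    refine ⟨Q, hQ, hQp, φ, hφ, hI, ?_⟩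
    rw [Set.mem_setOf_eq, ← splittingType_eq_fullCycleType_of_hom K' ψ hstab hK' hp Q hφ hI, hT]

end Field

/-! ### Existence: the coset representation of the Galois closure -/

/-- **Every number field has a Galois closure with a permutation representation.**  For a number field
`K` of degree `n` there are a Galois number field `N` with `[N:ℚ] ≤ n!` and `|d_N| ≤ |d_K|^{[N:ℚ]}`, an
embedding `f : K → N`, and a homomorphism `ψ : Gal(N/ℚ) → Perm (Fin n)` under which `Gal(N/f K)` is the
stabiliser of `0` (the action on the cosets of `Gal(N/f K)`, relabelled). -/
theorem exists_galoisClosure_perm (n : ℕ) [NeZero n] (K : Type) [Field K] [NumberField K]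
    (hK : Module.finrank ℚ K = n) :
    ∃ (N : Type) (_ : Field N) (_ : NumberField N), IsGalois ℚ N ∧
      Module.finrank ℚ N ≤ n.factorial ∧
      (NumberField.discr N).natAbs ≤ (NumberField.discr K).natAbs ^ Module.finrank ℚ N ∧
      ∃ (f : K →ₐ[ℚ] N) (ψ : (N ≃ₐ[ℚ] N) →* Equiv.Perm (Fin n)),
        ∀ g : N ≃ₐ[ℚ] N, g ∈ f.fieldRange.fixingSubgroup ↔ ψ g 0 = 0 := by
  classical
  obtain ⟨N, _, _, hGal, hdeg, -, ⟨f⟩, -, hdisc⟩ := exists_galoisClosure K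
  haveI := hGal
  refine ⟨N, inferInstance, inferInstance, hGal, hK ▸ hdeg, hdisc, f, ?_⟩
  set H : Subgroup (N ≃ₐ[ℚ] N) := f.fieldRange.fixingSubgroup with hH
  -- `[G : H] = n`, so `G ⧸ H` has `n` elements
  have hKf : Module.finrank ℚ f.fieldRange = n := by
    rw [← hK]; exact (f.equivFieldRange.toLinearEquiv.finrank_eq).symm
  have hind : H.index = n := (index_fixingSubgroup_eq_finrank f.fieldRange).trans hKf
  have hcard : Fintype.card ((N ≃ₐ[ℚ] N) ⧸ H) = n := by
    rw [← Nat.card_eq_fintype_card]; exact hind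
  -- number the cosets with `H ↦ 0`
  let e₁ : ((N ≃ₐ[ℚ] N) ⧸ H) ≃ Fin n := Fintype.equivFinOfCardEq hcard
  let e : ((N ≃ₐ[ℚ] N) ⧸ H) ≃ Fin n :=
    e₁.trans (Equiv.swap (e₁ ((1 : N ≃ₐ[ℚ] N) : (N ≃ₐ[ℚ] N) ⧸ H)) 0)
  have he : e ((1 : N ≃ₐ[ℚ] N) : (N ≃ₐ[ℚ] N) ⧸ H) = 0 := by simp [e, Equiv.swap_apply_left]
  let ψ : (N ≃ₐ[ℚ] N) →* Equiv.Perm (Fin n) :=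
    e.permCongrHom.toMonoidHom.comp (MulAction.toPermHom (N ≃ₐ[ℚ] N) ((N ≃ₐ[ℚ] N) ⧸ H))
  refine ⟨ψ, fun g => ?_⟩
  have h1 : ψ g 0 = e (g • e.symm 0) := rfl
  have h2 : e.symm 0 = ((1 : N ≃ₐ[ℚ] N) : (N ≃ₐ[ℚ] N) ⧸ H) := by
    rw [← he, Equiv.symm_apply_apply]
  rw [h1, h2, ← he, e.apply_eq_iff_eq, MulAction.Quotient.smul_coe, smul_eq_mul, mul_one,
    QuotientGroup.eq, mul_one, inv_mem_iff]

end Summit.QuantumAdvantage.QuantumAdvantage.Theorems.DegreeOnePrimesEscape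

end
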